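import Literature.Analysis.FluidPDE.EulerSubsolutionCriterionPieces
import Literature.Analysis.FluidPDE.EulerSubsolutionCriterionChart
import HarnessLib

/-!
# Székelyhidi's localized convex-integration theorem: reduction to the planar statement

Topic `Analysis/FluidPDE`. Third support file (after `EulerSubsolutionCriterionPieces.lean` and
`EulerSubsolutionCriterionChart.lean`) reducing the named fact `Torus.Szekelyhidi2011_thm13`
(`EulerSubsolutionCriterion.lean`; Székelyhidi, C. R. Math. 349 (2011), Thm. 1.3 = De Lellis–
Székelyhidi, Arch. Ration. Mech. Anal. 195 (2010), Prop. 2, localized to an open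
`U ⊆ (0,T) × T²`, every-time-slice form) to the corresponding **planar** statement on bounded
open regions `Ũ ⊆ (0,T) × (0,1)² ⊆ ℝ × ℝ²` with continuous data — the output of the
flat-coordinate construction of `ConvexIntegration2D*.lean` (Chiodaroli–De Lellis–Kreml
iteration over variable data with slice control):

* `Torus.Szekelyhidi2011_thm13_chart_of_planar` — the conclusion of `Szekelyhidi2011_thm13` for
  data whose region lies over the chart `proj '' (0,1)²`, from the planar statement: pull the
  data back along `(t, x) ↦ (t, proj x)`, solve on `Ũ = {(t, x) : x ∈ (0,1)², (t, proj x) ∈ U}`,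
  push the perturbation forward along the measure-preserving section `repr : T² → [0,1)²`; the
  weak identities transfer by `∫_{T²} F ∘ repr = ∫_{[0,1)²} F` and the lift formulas for
  `∂ₜ`, `D`, `∇`, after removing the compact-support condition on planar tests (cut-offs) and
  upgrading weak continuity from test fields to `L²` (density).
* `Torus.Szekelyhidi2011_thm13_of_planar` — **`Szekelyhidi2011_thm13` from the planar
  statement** (one chart of full measure, glued by `Szekelyhidi2011_thm13_of_pieces`).

The planar statement (hypothesis `H`, fields uncurried on `ℝ × ℝ²`, `ℝ² = EuclideanSpace ℝ (Fin 2)`,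
`∂ₜφ = Dφ(1,0)`, `∂ⱼφᵢ = (Dφ(0,eⱼ))ᵢ` as in `ConvexIntegration2D.lean`): for `Ũ` open,
`Ũ ⊆ (0,T) × (0,1)²`, data `(ē, v̄, ū)` continuous on `Ũ` with `ū` symmetric trace-free on `Ũ`,
`ē` bounded on `Ũ` and `v̄ ⊗ v̄ - ū < ē Id` on `Ũ`, there are `(ṽ, ũ)`: measurable, `ũ` symmetric
trace-free, `‖ṽ(t, ·)‖_∞ ≤ C` for every `t` and `|ũ| ≤ C` a.e., `ṽ(t, ·) ∈ L²` for every `t`,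
`t ↦ ∫ ṽ(t,x)·g(x) dx` continuous for smooth compactly supported `g`,
`∫∫ [ṽ·∂ₜφ + ũ : ∇φ] = 0` and `∫∫ ṽ·∇ₓθ = 0` for smooth compactly supported `φ`, `θ` on `ℝ × ℝ²`
(`∂ₜṽ + div ũ = 0`, `div ṽ = 0` in `𝒟'(ℝ × ℝ²)`, Chiodaroli–De Lellis–Kreml's (ii)),
`(ṽ, ũ) = 0` a.e. off `Ũ` and `ṽ(t, ·) = 0` a.e. off `Ũ_t` for every `t`, and
`(v̄ + ṽ) ⊗ (v̄ + ṽ) - (ū + ũ) = ē Id` a.e. in `Ũ` and, for every `t`, a.e. on `Ũ_t`. This is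
De Lellis–Székelyhidi 2010, Prop. 2 (with (iv) for every `t`) in the flat coordinates of
Székelyhidi 2011, proof of Thm. 1.3; no hypothesis on the linear system of the data is needed
(the perturbation solves the homogeneous system by itself).

Everything here is proved; there are no definitions and no new named facts.

## References

* L. Székelyhidi Jr., C. R. Math. Acad. Sci. Paris 349 (2011) 1063–1066, Def. 1.2, Thm. 1.3 and
  its proof (`Szekelyhidi2011`).
* C. De Lellis, L. Székelyhidi Jr., Arch. Ration. Mech. Anal. 195 (2010) 225–260, Prop. 2, §4
  (`DeLellisSzekelyhidi2010`).
* E. Chiodaroli, C. De Lellis, O. Kreml, Comm. Pure Appl. Math. 68 (2015) 1157–1190, Lemma 3.7,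
  §4 (`ChiodaroliDeLellisKreml2015`).
-/

open MeasureTheory Set Filter Function Metric
open scoped InnerProductSpace ContDiff Topology ENNReal
open Literature.Analysis.FunctionSpaces
open Literature.Analysis.FunctionSpaces.Torus

noncomputable section

namespace Literature.Analysis.FluidPDE

namespace Torus

/-! ### The planar statement over the open unit square implies the torus statement over the chart -/

section Planar

/-- **Székelyhidi's Thm. 1.3 over the unit-square chart, from the planar statement.** If the
every-time-slice conclusion of De Lellis–Székelyhidi's Prop. 2 is available on `ℝ × ℝ²` for
continuous strict-subsolution data on open regions `Ũ ⊆ (0,T) × (0,1)²` (perturbations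
`(ṽ, ũ) ∈ L^∞`, `ũ` symmetric trace-free, `ṽ ∈ C(ℝ; L²_w)` tested against smooth compactly
supported fields, `∂ₜṽ + div ũ = 0` and `div ṽ = 0` in `𝒟'`, supports in `Ũ`, and the
constitutive identity a.e. in `Ũ` and on every time slice), then the conclusion of
`Szekelyhidi2011_thm13` holds for every torus datum whose region lies over the chart
`proj '' (0,1)²`: pull the data back along `(t, x) ↦ (t, proj x)`, apply the planar statement on
`Ũ = {(t, x) : x ∈ (0,1)², (t, proj x) ∈ U}`, and push the perturbation forward along the
measure-preserving section `repr : T² → [0,1)²` (`EulerSubsolutionCriterionChart`).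
[cite: Szekelyhidi2011, Thm. 1.3 and its proof] [cite: DeLellisSzekelyhidi2010, Prop. 2] -/
theorem Szekelyhidi2011_thm13_chart_of_planar
    (H : ∀ (T : ℝ) (e : ℝ × EuclideanSpace ℝ (Fin 2) → ℝ)
      (v : ℝ × EuclideanSpace ℝ (Fin 2) → EuclideanSpace ℝ (Fin 2))
      (u : ℝ × EuclideanSpace ℝ (Fin 2) → Matrix (Fin 2) (Fin 2) ℝ)
      (U : Set (ℝ × EuclideanSpace ℝ (Fin 2))),
      IsOpen U → U ⊆ Ioo 0 T ×ˢ {x : EuclideanSpace ℝ (Fin 2) | ∀ i, x i ∈ Ioo (0 : ℝ) 1} →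
      ContinuousOn e U → ContinuousOn v U →
      (∀ i j, ContinuousOn (fun p : ℝ × EuclideanSpace ℝ (Fin 2) => u p i j) U) →
      (∀ p ∈ U, (u p).IsSymm ∧ (u p).trace = 0) →
      (∃ M : ℝ, ∀ p ∈ U, e p ≤ M) →
      (∀ p ∈ U, ((e p) • (1 : Matrix (Fin 2) (Fin 2) ℝ) -
        (Matrix.vecMulVec (v p) (v p) - u p)).PosDef) →
      ∃ (w : ℝ × EuclideanSpace ℝ (Fin 2) → EuclideanSpace ℝ (Fin 2))
        (z : ℝ × EuclideanSpace ℝ (Fin 2) → Matrix (Fin 2) (Fin 2) ℝ),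
        AEStronglyMeasurable w volume ∧
        (∀ i j, AEStronglyMeasurable (fun p : ℝ × EuclideanSpace ℝ (Fin 2) => z p i j) volume) ∧
        (∃ C : ℝ, (∀ t : ℝ, ∀ᵐ x : EuclideanSpace ℝ (Fin 2) ∂volume, ‖w (t, x)‖ ≤ C) ∧
          ∀ i j, ∀ᵐ p : ℝ × EuclideanSpace ℝ (Fin 2) ∂volume, |z p i j| ≤ C) ∧
        (∀ p, (z p).IsSymm ∧ (z p).trace = 0) ∧
        (∀ t : ℝ, MemLp (fun x : EuclideanSpace ℝ (Fin 2) => w (t, x)) 2 volume) ∧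
        (∀ g : EuclideanSpace ℝ (Fin 2) → EuclideanSpace ℝ (Fin 2), ContDiff ℝ ∞ g →
          HasCompactSupport g → Continuous fun t : ℝ => ∫ x, ⟪w (t, x), g x⟫_ℝ) ∧
        (∀ φ : ℝ × EuclideanSpace ℝ (Fin 2) → EuclideanSpace ℝ (Fin 2), ContDiff ℝ ∞ φ →
          HasCompactSupport φ →
          ∫ p, (⟪w p, fderiv ℝ φ p (1, 0)⟫_ℝ +
            ∑ i, ∑ j, z p i j * fderiv ℝ φ p (0, EuclideanSpace.single j 1) i) = 0) ∧
        (∀ φ : ℝ × EuclideanSpace ℝ (Fin 2) → ℝ, ContDiff ℝ ∞ φ → HasCompactSupport φ →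
          ∫ p, ∑ j, w p j * fderiv ℝ φ p (0, EuclideanSpace.single j 1) = 0) ∧
        (∀ᵐ p ∂volume, p ∉ U → w p = 0 ∧ z p = 0) ∧
        (∀ t : ℝ, ∀ᵐ x : EuclideanSpace ℝ (Fin 2) ∂volume, (t, x) ∉ U → w (t, x) = 0) ∧
        (∀ᵐ p ∂volume, p ∈ U →
          Matrix.vecMulVec (v p + w p) (v p + w p) - (u p + z p) =
            (e p) • (1 : Matrix (Fin 2) (Fin 2) ℝ)) ∧
        (∀ t : ℝ, ∀ᵐ x : EuclideanSpace ℝ (Fin 2) ∂volume, (t, x) ∈ U →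
          Matrix.vecMulVec (v (t, x) + w (t, x)) (v (t, x) + w (t, x)) - (u (t, x) + z (t, x)) =
            (e (t, x)) • (1 : Matrix (Fin 2) (Fin 2) ℝ)))
    (T : ℝ) (e : ℝ → UnitAddTorus (Fin 2) → ℝ)
    (v : ℝ → UnitAddTorus (Fin 2) → EuclideanSpace ℝ (Fin 2))
    (u : ℝ → UnitAddTorus (Fin 2) → Matrix (Fin 2) (Fin 2) ℝ)
    (q : ℝ → UnitAddTorus (Fin 2) → ℝ) (U : Set (ℝ × UnitAddTorus (Fin 2)))
    (hsub : IsEulerSubsolutionOn T e v u q) (hUo : IsOpen U)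
    (hUT : U ⊆ Ioo 0 T ×ˢ (proj '' {x : EuclideanSpace ℝ (Fin 2) | ∀ i, x i ∈ Ioo (0 : ℝ) 1}))
    (hec : ContinuousOn (uncurry e) U) (hvc : ContinuousOn (uncurry v) U)
    (huc : ∀ i j, ContinuousOn (fun p : ℝ × UnitAddTorus (Fin 2) => u p.1 p.2 i j) U)
    (_hqc : ContinuousOn (uncurry q) U)
    (hM : ∃ M : ℝ, ∀ p ∈ U, e p.1 p.2 ≤ M)
    (hpos : ∀ p ∈ U, ((e p.1 p.2) • (1 : Matrix (Fin 2) (Fin 2) ℝ) -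
      (Matrix.vecMulVec (v p.1 p.2) (v p.1 p.2) - u p.1 p.2)).PosDef) :
    ∃ (w : ℝ → UnitAddTorus (Fin 2) → EuclideanSpace ℝ (Fin 2))
      (z : ℝ → UnitAddTorus (Fin 2) → Matrix (Fin 2) (Fin 2) ℝ),
      AEStronglyMeasurable (uncurry w) volume ∧
      (∀ i j, AEStronglyMeasurable (fun p : ℝ × UnitAddTorus (Fin 2) => z p.1 p.2 i j) volume) ∧
      (∃ C : ℝ, (∀ t, ∀ᵐ x ∂volume, ‖w t x‖ ≤ C) ∧
        ∀ i j, ∀ᵐ p : ℝ × UnitAddTorus (Fin 2) ∂volume, |z p.1 p.2 i j| ≤ C) ∧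
      (∀ t x, (z t x).IsSymm ∧ (z t x).trace = 0) ∧
      (∀ t, MemLp (w t) 2 volume) ∧
      (∀ g : UnitAddTorus (Fin 2) → EuclideanSpace ℝ (Fin 2), MemLp g 2 volume →
        Continuous fun t => ∫ x, ⟪w t x, g x⟫_ℝ) ∧
      (∀ φ : ℝ → UnitAddTorus (Fin 2) → EuclideanSpace ℝ (Fin 2), ContDiff ℝ ∞ (stLift φ) →
        ∫ t in Ioo 0 T, ∫ x, (⟪w t x, timeDeriv φ t x⟫_ℝ +
          ∑ i, ∑ j, z t x i j *
            FunctionSpaces.Torus.fderiv (φ t) x (EuclideanSpace.single j 1) i) = 0) ∧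
      (∀ t, IsWeaklyDivFree (w t)) ∧
      (∀ᵐ p : ℝ × UnitAddTorus (Fin 2) ∂volume, p ∉ U → w p.1 p.2 = 0 ∧ z p.1 p.2 = 0) ∧
      (∀ t, ∀ᵐ x ∂volume, (t, x) ∉ U → w t x = 0) ∧
      (∀ᵐ p : ℝ × UnitAddTorus (Fin 2) ∂volume, p ∈ U →
        Matrix.vecMulVec (v p.1 p.2 + w p.1 p.2) (v p.1 p.2 + w p.1 p.2) -
          (u p.1 p.2 + z p.1 p.2) = (e p.1 p.2) • (1 : Matrix (Fin 2) (Fin 2) ℝ)) ∧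
      (∀ t, ∀ᵐ x ∂volume, (t, x) ∈ U →
        Matrix.vecMulVec (v t x + w t x) (v t x + w t x) - (u t x + z t x) =
          (e t x) • (1 : Matrix (Fin 2) (Fin 2) ℝ)) := by
  -- the open unit square and the planar region over `U`
  set S : Set (EuclideanSpace ℝ (Fin 2)) := {x | ∀ i, x i ∈ Ioo (0 : ℝ) 1} with hS_def
  have hSo : IsOpen S := isOpen_setOf_mem_Ioo
  have hScube : S ⊆ unitCube (Fin 2) := setOf_mem_Ioo_subset_unitCube
  have hSbdd : Bornology.IsBounded S := by
    refine (isBounded_iff_forall_norm_le.2 ⟨2, fun x hx => ?_⟩)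
    rw [EuclideanSpace.norm_eq]
    have h : ∑ i, x i ^ 2 ≤ 2 := by
      calc ∑ i, x i ^ 2 ≤ ∑ _i : Fin 2, (1 : ℝ) := Finset.sum_le_sum fun i _ => by
            have := hx i; rw [mem_Ioo] at this; nlinarith
        _ = 2 := by simp
    calc Real.sqrt (∑ i, ‖x i‖ ^ 2) = Real.sqrt (∑ i, x i ^ 2) := by simp [Real.norm_eq_abs, sq_abs]
      _ ≤ Real.sqrt 4 := Real.sqrt_le_sqrt (by linarith)
      _ = 2 := by rw [show (4 : ℝ) = 2 ^ 2 by norm_num, Real.sqrt_sq (by norm_num)]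
  set P : ℝ × EuclideanSpace ℝ (Fin 2) → ℝ × UnitAddTorus (Fin 2) := fun p => (p.1, proj p.2)
    with hP_def
  have hPc : Continuous P := continuous_fst.prodMk (continuous_proj.comp continuous_snd)
  set Up : Set (ℝ × EuclideanSpace ℝ (Fin 2)) := {p | p.2 ∈ S ∧ P p ∈ U} with hUp_def
  have hUpo : IsOpen Up := (hSo.preimage continuous_snd).inter (hUo.preimage hPc)
  have hUpsub : Up ⊆ Ioo 0 T ×ˢ S := fun p hp => ⟨(hUT hp.2).1, hp.1⟩
  have hmaps : MapsTo P Up U := fun p hp => hp.2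
  -- membership bookkeeping between `U` and `Up`
  have hrepr_of_mem : ∀ {p : ℝ × UnitAddTorus (Fin 2)}, p ∈ U → (p.1, repr p.2) ∈ Up := by
    intro p hp
    have h2 : repr p.2 ∈ S := (mem_image_proj_iff hScube p.2).1 (hUT hp).2
    refine ⟨h2, ?_⟩
    show (p.1, proj (repr p.2)) ∈ U
    rw [proj_repr]; exact hp
  have hmem_of_repr : ∀ {p : ℝ × UnitAddTorus (Fin 2)}, (p.1, repr p.2) ∈ Up → p ∈ U := by
    intro p hp
    have h := hp.2
    change (p.1, proj (repr p.2)) ∈ U at h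
    rwa [proj_repr] at h
  -- the planar data
  obtain ⟨w, z, hwm, hzm, ⟨C, hwC, hzC⟩, hsymm, hw2, hwc, hpde, hdivST, hoff, hoffs, h6, h6s⟩ :=
    H T (fun p => e p.1 (proj p.2)) (fun p => v p.1 (proj p.2)) (fun p => u p.1 (proj p.2)) Up hUpo
      hUpsub (hec.comp hPc.continuousOn hmaps) (hvc.comp hPc.continuousOn hmaps)
      (fun i j => (huc i j).comp hPc.continuousOn hmaps)
      (fun p _ => ⟨hsub.stress_symm _ _, hsub.stress_trace _ _⟩)
      (hM.imp fun M hM' => fun p hp => hM' (P p) (hmaps hp)) (fun p hp => hpos (P p) (hmaps hp))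
  -- weak incompressibility on every slice, from the space–time form and weak continuity
  have hdiv : ∀ (t : ℝ) (θ : EuclideanSpace ℝ (Fin 2) → ℝ), ContDiff ℝ ∞ θ → HasCompactSupport θ →
      ∫ x, ⟪w (t, x), _root_.gradient θ x⟫_ℝ = 0 := fun t θ hθ hθc =>
    integral_inner_gradient_eq_zero_of_spaceTime hwm hwC hwc hdivST t hθ hθc
  -- auxiliary facts on the planar perturbation
  have hw0S : ∀ t, ∀ᵐ x : EuclideanSpace ℝ (Fin 2) ∂volume, (t, x) ∉ Ioo 0 T ×ˢ S → w (t, x) = 0 :=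
    fun t => (hoffs t).mono fun x hx h => hx fun h' => h (hUpsub h')
  have hz0S : ∀ᵐ p : ℝ × EuclideanSpace ℝ (Fin 2) ∂volume, p ∉ Ioo 0 T ×ˢ S → z p = 0 :=
    hoff.mono fun p hp h => (hp fun h' => h (hUpsub h')).2
  have hw0cube : ∀ t, ∀ᵐ x : EuclideanSpace ℝ (Fin 2) ∂volume, x ∉ unitCube (Fin 2) → w (t, x) = 0 :=
    fun t => (hw0S t).mono fun x hx h => hx fun h' => h (hScube h'.2)
  have hz0slice : ∀ᵐ t : ℝ, ∀ᵐ x : EuclideanSpace ℝ (Fin 2),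
      (t, x) ∉ Ioo 0 T ×ˢ S → z (t, x) = 0 := by
    rw [Measure.volume_eq_prod] at hz0S
    exact Measure.ae_ae_of_ae_prod hz0S
  -- the transplanted fields
  refine ⟨fun t y => w (t, repr y), fun t y => z (t, repr y),
    ?_, ?_, ⟨C, ?_, ?_⟩, ?_, ?_, ?_, ?_, ?_, ?_, ?_, ?_, ?_⟩
  · -- joint measurability of `ṽ`
    exact hwm.comp_quasiMeasurePreserving quasiMeasurePreserving_prodMap_repr
  · -- joint measurability of the entries of `ũ`
    intro i j
    exact (hzm i j).comp_quasiMeasurePreserving quasiMeasurePreserving_prodMap_repr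
  · -- slice bound
    intro t
    exact ae_comp_repr (hwC t)
  · -- stress bound
    intro i j
    exact ae_comp_prodMap_repr (hzC i j)
  · -- symmetric, trace-free
    intro t x
    exact hsymm _
  · -- `L²` slices
    intro t
    exact ((hw2 t).restrict (unitCube (Fin 2))).comp_measurePreserving measurePreserving_repr
  · -- weak continuity into `L²`
    intro g hg
    beta_reduce
    -- the planar `L²` field seen by the pairing
    set G : EuclideanSpace ℝ (Fin 2) → EuclideanSpace ℝ (Fin 2) :=
      (unitCube (Fin 2)).indicator (g ∘ proj) with hG_def
    have hgp : MemLp (g ∘ proj) 2 (volume.restrict (unitCube (Fin 2))) :=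
      hg.comp_measurePreserving measurePreserving_proj_unitCube_holds
    have hG : MemLp G 2 volume := (memLp_indicator_iff_restrict measurableSet_unitCube).2 hgp
    have hpair : ∀ t, ∫ y, ⟪w (t, repr y), g y⟫_ℝ = ∫ x, ⟪w (t, x), G x⟫_ℝ := by
      intro t
      have h1 : ∫ y, ⟪w (t, repr y), g y⟫_ℝ =
          ∫ y, (fun x => ⟪w (t, x), g (proj x)⟫_ℝ) (repr y) := by
        simp only [proj_repr]
      rw [h1, integral_comp_repr (fun x => ⟪w (t, x), g (proj x)⟫_ℝ),
        ← integral_indicator measurableSet_unitCube]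
      refine integral_congr_ae (ae_of_all _ fun x => ?_)
      by_cases hxc : x ∈ unitCube (Fin 2)
      · simp only [hG_def, indicator_of_mem hxc, Function.comp_apply]
      · simp only [hG_def, indicator_of_notMem hxc, inner_zero_right]
    simp_rw [hpair]
    -- uniform `L²` bound of the planar slices (supported in the unit cube, of measure `1`)
    have hvol : (volume.restrict (unitCube (Fin 2))) (univ : Set (EuclideanSpace ℝ (Fin 2))) = 1 := by
      rw [← (measurePreserving_repr (d := Fin 2)).map_eq, Measure.map_apply measurable_repr
        MeasurableSet.univ, preimage_univ, measure_univ]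
    have hB : ∀ t, (eLpNorm (fun x => w (t, x)) 2 volume).toReal ≤ |C| := by
      intro t
      have hind : (fun x => w (t, x)) =ᵐ[volume]
          (unitCube (Fin 2)).indicator (fun x => w (t, x)) := by
        filter_upwards [hw0cube t] with x hx
        by_cases hxc : x ∈ unitCube (Fin 2)
        · rw [indicator_of_mem hxc]
        · rw [indicator_of_notMem hxc, hx hxc]
      rw [eLpNorm_congr_ae hind, eLpNorm_indicator_eq_eLpNorm_restrict measurableSet_unitCube]
      have hle : eLpNorm (fun x => w (t, x)) 2 (volume.restrict (unitCube (Fin 2))) ≤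
          (volume.restrict (unitCube (Fin 2))) univ ^ (2 : ℝ≥0∞).toReal⁻¹ * ENNReal.ofReal |C| :=
        eLpNorm_le_of_ae_bound
          (ae_restrict_of_ae ((hwC t).mono fun x hx => hx.trans (le_abs_self C)))
      rw [hvol, ENNReal.one_rpow, one_mul] at hle
      exact ENNReal.toReal_le_of_le_ofReal (abs_nonneg C) hle
    exact continuous_integral_inner_of_test hw2 hB hwc hG
  · -- the linear system
    intro ψ hψ
    beta_reduce
    set Fpl : ℝ × EuclideanSpace ℝ (Fin 2) → ℝ := fun p => ⟪w p, fderiv ℝ (stLift ψ) p (1, 0)⟫_ℝ +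
      ∑ i, ∑ j, z p i j * fderiv ℝ (stLift ψ) p (0, EuclideanSpace.single j 1) i with hFpl_def
    -- the torus integrand at `y` is the planar one at `repr y`
    have hpt : ∀ (t : ℝ) (y : UnitAddTorus (Fin 2)),
        ⟪w (t, repr y), timeDeriv ψ t y⟫_ℝ + ∑ i, ∑ j, z (t, repr y) i j *
          FunctionSpaces.Torus.fderiv (ψ t) y (EuclideanSpace.single j 1) i = Fpl (t, repr y) := by
      intro t y
      have ht := timeDeriv_apply_proj hψ t (repr y)
      have hx := fun j i => congrArg (fun v : EuclideanSpace ℝ (Fin 2) => v i)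
        (fderiv_slice_apply_proj hψ t (repr y) (EuclideanSpace.single j 1))
      rw [proj_repr] at ht
      simp only [proj_repr] at hx
      simp only [hFpl_def, ht, hx]
    have hstep1 : ∀ t, ∫ y, (⟪w (t, repr y), timeDeriv ψ t y⟫_ℝ + ∑ i, ∑ j, z (t, repr y) i j *
        FunctionSpaces.Torus.fderiv (ψ t) y (EuclideanSpace.single j 1) i) =
        ∫ x in unitCube (Fin 2), Fpl (t, x) := by
      intro t
      simp_rw [hpt]
      exact integral_comp_repr fun x => Fpl (t, x)
    have hstep2 : ∫ t in Ioo 0 T, ∫ x in unitCube (Fin 2), Fpl (t, x) =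
        ∫ t in Ioo 0 T, ∫ x, Fpl (t, x) := by
      refine setIntegral_congr_ae measurableSet_Ioo ?_
      filter_upwards [hz0slice] with t hzt _
      refine setIntegral_eq_integral_of_ae_compl_eq_zero ?_
      filter_upwards [hw0cube t, hzt] with x hwx hzx hxc
      have hxS : (t, x) ∉ Ioo 0 T ×ˢ S := fun h => hxc (hScube h.2)
      simp [hFpl_def, hwx hxc, hzx hxS]
    rw [integral_congr_ae (ae_of_all _ fun t => hstep1 t), hstep2]
    exact setIntegral_weakIntegrand_eq_zero_of_test hSbdd hwm hzm hwC hzC hw0S hz0S hpde hψ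
  · -- weak incompressibility on every slice
    intro t θ hθ
    beta_reduce
    have h1 : ∫ y, ⟪w (t, repr y), FunctionSpaces.Torus.gradient θ y⟫_ℝ =
        ∫ y, (fun x => ⟪w (t, x), _root_.gradient (lift θ) x⟫_ℝ) (repr y) := by
      simp only [gradient_lift, proj_repr]
    rw [h1, integral_comp_repr (fun x => ⟪w (t, x), _root_.gradient (lift θ) x⟫_ℝ)]
    have h2 : ∫ x in unitCube (Fin 2), ⟪w (t, x), _root_.gradient (lift θ) x⟫_ℝ =
        ∫ x, ⟪w (t, x), _root_.gradient (lift θ) x⟫_ℝ := by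
      refine setIntegral_eq_integral_of_ae_compl_eq_zero ?_
      filter_upwards [hw0cube t] with x hx hxc
      rw [hx hxc, inner_zero_left]
    rw [h2]
    exact integral_inner_gradient_eq_zero_of_test hSbdd
      ((hw0S t).mono fun x hx hxS => hx fun h => hxS h.2) (hdiv t) hθ
  · -- vanishing off `U` a.e.
    filter_upwards [ae_comp_prodMap_repr hoff] with p hp hpU
    exact hp fun h => hpU (hmem_of_repr h)
  · -- vanishing of `ṽ` off `U` on every slice
    intro t
    filter_upwards [ae_comp_repr (hoffs t)] with y hy hyU
    exact hy fun h => hyU (hmem_of_repr (p := (t, y)) h)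
  · -- (6) a.e. in `U`
    filter_upwards [ae_comp_prodMap_repr h6] with p hp hpU
    have h := hp (hrepr_of_mem hpU)
    simpa only [proj_repr] using h
  · -- (6) on every slice
    intro t
    filter_upwards [ae_comp_repr (h6s t)] with y hy hyU
    have h := hy (hrepr_of_mem (p := (t, y)) hyU)
    simpa only [proj_repr] using h


/-- **Székelyhidi's localized convex-integration theorem on the torus from the planar
statement over the unit square.** Combine the single chart `proj '' (0,1)²` — open, of full
measure in `T²` (`ae_repr_mem_setOf_mem_Ioo`) — with the gluing theorem
`Szekelyhidi2011_thm13_of_pieces` (one piece) and `Szekelyhidi2011_thm13_chart_of_planar`. With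
this theorem the named fact `Torus.Szekelyhidi2011_thm13` is reduced to De Lellis–Székelyhidi's
Prop. 2 in flat coordinates on bounded open regions `Ũ ⊆ (0,T) × (0,1)² ⊆ ℝ × ℝ²` with
continuous data, in its every-time-slice form — the statement produced by the constructive
iteration of `ConvexIntegration2D*.lean`.
[cite: Szekelyhidi2011, Thm. 1.3 and its proof] [cite: DeLellisSzekelyhidi2010, Prop. 2, §4] -/
theorem Szekelyhidi2011_thm13_of_planar
    (H : ∀ (T : ℝ) (e : ℝ × EuclideanSpace ℝ (Fin 2) → ℝ)
      (v : ℝ × EuclideanSpace ℝ (Fin 2) → EuclideanSpace ℝ (Fin 2))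
      (u : ℝ × EuclideanSpace ℝ (Fin 2) → Matrix (Fin 2) (Fin 2) ℝ)
      (U : Set (ℝ × EuclideanSpace ℝ (Fin 2))),
      IsOpen U → U ⊆ Ioo 0 T ×ˢ {x : EuclideanSpace ℝ (Fin 2) | ∀ i, x i ∈ Ioo (0 : ℝ) 1} →
      ContinuousOn e U → ContinuousOn v U →
      (∀ i j, ContinuousOn (fun p : ℝ × EuclideanSpace ℝ (Fin 2) => u p i j) U) →
      (∀ p ∈ U, (u p).IsSymm ∧ (u p).trace = 0) →
      (∃ M : ℝ, ∀ p ∈ U, e p ≤ M) →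
      (∀ p ∈ U, ((e p) • (1 : Matrix (Fin 2) (Fin 2) ℝ) -
        (Matrix.vecMulVec (v p) (v p) - u p)).PosDef) →
      ∃ (w : ℝ × EuclideanSpace ℝ (Fin 2) → EuclideanSpace ℝ (Fin 2))
        (z : ℝ × EuclideanSpace ℝ (Fin 2) → Matrix (Fin 2) (Fin 2) ℝ),
        AEStronglyMeasurable w volume ∧
        (∀ i j, AEStronglyMeasurable (fun p : ℝ × EuclideanSpace ℝ (Fin 2) => z p i j) volume) ∧
        (∃ C : ℝ, (∀ t : ℝ, ∀ᵐ x : EuclideanSpace ℝ (Fin 2) ∂volume, ‖w (t, x)‖ ≤ C) ∧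
          ∀ i j, ∀ᵐ p : ℝ × EuclideanSpace ℝ (Fin 2) ∂volume, |z p i j| ≤ C) ∧
        (∀ p, (z p).IsSymm ∧ (z p).trace = 0) ∧
        (∀ t : ℝ, MemLp (fun x : EuclideanSpace ℝ (Fin 2) => w (t, x)) 2 volume) ∧
        (∀ g : EuclideanSpace ℝ (Fin 2) → EuclideanSpace ℝ (Fin 2), ContDiff ℝ ∞ g →
          HasCompactSupport g → Continuous fun t : ℝ => ∫ x, ⟪w (t, x), g x⟫_ℝ) ∧
        (∀ φ : ℝ × EuclideanSpace ℝ (Fin 2) → EuclideanSpace ℝ (Fin 2), ContDiff ℝ ∞ φ →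
          HasCompactSupport φ →
          ∫ p, (⟪w p, fderiv ℝ φ p (1, 0)⟫_ℝ +
            ∑ i, ∑ j, z p i j * fderiv ℝ φ p (0, EuclideanSpace.single j 1) i) = 0) ∧
        (∀ φ : ℝ × EuclideanSpace ℝ (Fin 2) → ℝ, ContDiff ℝ ∞ φ → HasCompactSupport φ →
          ∫ p, ∑ j, w p j * fderiv ℝ φ p (0, EuclideanSpace.single j 1) = 0) ∧
        (∀ᵐ p ∂volume, p ∉ U → w p = 0 ∧ z p = 0) ∧
        (∀ t : ℝ, ∀ᵐ x : EuclideanSpace ℝ (Fin 2) ∂volume, (t, x) ∉ U → w (t, x) = 0) ∧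
        (∀ᵐ p ∂volume, p ∈ U →
          Matrix.vecMulVec (v p + w p) (v p + w p) - (u p + z p) =
            (e p) • (1 : Matrix (Fin 2) (Fin 2) ℝ)) ∧
        (∀ t : ℝ, ∀ᵐ x : EuclideanSpace ℝ (Fin 2) ∂volume, (t, x) ∈ U →
          Matrix.vecMulVec (v (t, x) + w (t, x)) (v (t, x) + w (t, x)) - (u (t, x) + z (t, x)) =
            (e (t, x)) • (1 : Matrix (Fin 2) (Fin 2) ℝ))) :
    Szekelyhidi2011_thm13 := by
  refine Szekelyhidi2011_thm13_of_pieces (ι := Unit)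
    (fun _ => proj '' {x : EuclideanSpace ℝ (Fin 2) | ∀ i, x i ∈ Ioo (0 : ℝ) 1})
    (fun _ => isOpen_image_proj isOpen_setOf_mem_Ioo)
    (fun k l hkl => absurd (Subsingleton.elim k l) hkl) ?_
    (fun _ => Szekelyhidi2011_thm13_chart_of_planar H)
  filter_upwards [ae_repr_mem_setOf_mem_Ioo (d := Fin 2)] with y hy
  exact ⟨(), (mem_image_proj_iff setOf_mem_Ioo_subset_unitCube y).2 hy⟩

end Planar

end Torus

end Literature.Analysis.FluidPDE
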